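import Summits.FinalStateConjecture.FinalStateConjecture.Theorems.EIHFluxBalanceInertialRecessionStubFirstOrderCoreA
import Summits.FinalStateConjecture.FinalStateConjecture.Theorems.EIHFluxBalanceInertialRecessionStubSlaving3ZeroSet
import Summits.FinalStateConjecture.FinalStateConjecture.Theorems.EIHFluxBalanceInertialRecessionStubSlaving3Perturb

/-!
# Route EIHFluxBalance — `InertialRecession` (E′), skeleton r13, stub `stub_firstOrderSlaving` (D),
# part 11: the estimate of the own-hole rows at a lab event (linear absorption, pointwise)

Helper file for the crux `stmt-FinalStateConjecture-17403` (E′), stub (D). At a lab event `x` of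
the slice `{x⁰ = t}` near hole `i` where the frozen background `G_t` is coercive, all rest-frame
radii are positive, the own summand and own variation field obey the shell bounds (`B`), the other
frozen summands are `C²`-small (`δ_f`), the other variation fields are small relative to their
reduced rates (`δ_v`), and the momentum clause (M) holds with relative smallness `ε₁`:
`Σ_k |Ric(G_t + (x⁰−t)Vᵢ)(♯dx⁰,e_{k+1}) − Ric(G_t)(♯dx⁰,e_{k+1})|
  ≤ 3 (ε₁ (B+N+1)(1 + Σⱼ redⱼ) + C_pert δ_f s + C_ML (1+B+N) δ_v Σⱼ redⱼ)` — the rows split over the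
holes (ML.i), the painted ansatz has the rows of `G_univ` (`W`-invisibility), the far rows are
small (ML.ii), and the rows of `G_t` are small (Ricci-flat own summand + `C²`-small perturbation).
No definitions, no named facts.
-/

set_option linter.dupNamespace false
set_option maxSynthPendingDepth 6

noncomputable section

open scoped Topology BigOperators
open Filter Set Function Metric Literature.Geometry.Lorentzian Literature.Geometry.Lorentzian.MetricCoord
  Summit.FinalStateConjecture.FinalStateConjecture.Theorems

namespace Summit.FinalStateConjecture.FinalStateConjecture.Theorems.SublinearIsFree.Slaving

/-! ### The chain of estimates at a lab event -/

section CoreB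

variable {N : ℕ} {M a : Fin N → ℝ} {Λ : Fin N → ℝ → lorentzGroup} {ξ : Fin N → ℝ → E3}

-- the algebraic and the operator-norm instance paths on `E4 →L[ℝ] E4 →L[ℝ] ℝ` unify slowly
set_option synthInstance.maxHeartbeats 200000 in
set_option maxHeartbeats 6400000 in
/-- **The own-hole rows at a lab event are relatively small (the pointwise estimate of the linear
absorption).** See the module docstring. [cite: KerrSchild1965, §3] -/
theorem firstOrder_coreB (ML₁ : (∀ {G G₁ G₂ G₃ : E4 → E4 →L[ℝ] E4 →L[ℝ] ℝ} {V : Set E4} {x : E4} {n : E4 →L[ℝ] ℝ} {A₁ A₂ : E4 →L[ℝ] E4 →L[ℝ] ℝ} {P₁ P₂ : E4 →L[ℝ] E4 →L[ℝ] E4 →L[ℝ] ℝ} {W₁ W₂ W₃ : E4 →L[ℝ] E4 →L[ℝ] ℝ} (c₁ c₂ : ℝ), MetricCoord.IsMetricOn G V → MetricCoord.IsMetricOn G₁ V → MetricCoord.IsMetricOn G₂ V → MetricCoord.IsMetricOn G₃ V → x ∈ V → G₁ x = G x → G₂ x = G x → G₃ x = G x → fderiv ℝ G₁ x = fderiv ℝ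 G x + n.smulRight A₁ → fderiv ℝ G₂ x = fderiv ℝ G x + n.smulRight A₂ → fderiv ℝ G₃ x = fderiv ℝ G x + n.smulRight (c₁ • A₁ + c₂ • A₂) → (∀ v, fderiv ℝ (fderiv ℝ G₁) x v = fderiv ℝ (fderiv ℝ G) x v + (n v • P₁ + n.smulRight (P₁ v) + n v • n.smulRight W₁)) → (∀ v, fderiv ℝ (fderiv ℝ G₂) x v = fderiv ℝ (fderiv ℝ G) x v + (n v • P₂ + n.smulRight (P₂ v) + n v • n.smulRight W₂)) → (∀ v, fderiv ℝ (fderiv ℝ G₃) x v = fderiv ℝ (fderiv ℝ G) x v + (n v • (c₁ • P₁ + c₂ • P₂) + n.smulRight ((c₁ • P₁ + c₂ • P₂) v) + n v • n.smulRight W₃)) → ∀ e : E4, n e = 0 → MetricCoord.ricAt G₃ x (MetricCoord.sharpAt G x n) e - MetricCoord.ricAt G x (MetricCoord.sharpAt G x n) e = c₁ * (MetricCoord.ricAt G₁ x (MetricCoord.sharpAt G x n) e - MetricCoord.ricAt G x (MetricCoord.sharpAt G x n) e) + c₂ * (MetricCoord.ricAt G₂ x (MetricCoord.sharpAt G x n)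 e - MetricCoord.ricAt G x (MetricCoord.sharpAt G x n) e))) {C μ ν : ℝ}
    (ML₂ : ∀ {G G₁ : E4 → E4 →L[ℝ] E4 →L[ℝ] ℝ} {V : Set E4} {x : E4} {n : E4 →L[ℝ] ℝ} {A : E4 →L[ℝ] E4 →L[ℝ] ℝ} {P : E4 →L[ℝ] E4 →L[ℝ] E4 →L[ℝ] ℝ} {W : E4 →L[ℝ] E4 →L[ℝ] ℝ}, MetricCoord.IsMetricOn G V → MetricCoord.IsMetricOn G₁ V → x ∈ V → (∀ v : E4, μ * ‖v‖ ≤ ‖G x v‖) → ‖G x‖ ≤ ν → G₁ x = G x → fderiv ℝ G₁ x = fderiv ℝ G x + n.smulRight A → (∀ v, fderiv ℝ (fderiv ℝ G₁) x v = fderiv ℝ (fderiv ℝ G) x v + (n v • P + n.smulRight (P v) + n v • n.smulRight W)) → ∀ e : E4, n e = 0 → |MetricCoord.ricAt G₁ x (MetricCoord.sharpAt G x n) e - MetricCoord.ricAt G x (MetricCoord.sharpAt G x n) e| ≤ C * (1 + ‖fderiv ℝ G x‖) * (‖A‖ + ‖P‖) * ‖n‖ ^ 2 * ‖e‖)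
    (hsm : (∀ i, ContDiff ℝ ((⊤ : ℕ∞) : WithTop ℕ∞) (ξ i) ∧ ContDiff ℝ ((⊤ : ℕ∞) : WithTop ℕ∞) (fun t ↦ ((Λ i t : E4 ≃L[ℝ] E4) : E4 →L[ℝ] E4))))
    (i : Fin N) {t : ℝ} {x : E4} (hx0 : x 0 = t)
    (hU : ∀ j, 0 < Kerr.radius (a j) (poincareInv (Λ j t) (E4.ofTimeSpace t (ξ j t)) x))
    (hμ : 0 < μ) (hcoer : ∀ v : E4, μ * ‖v‖ ≤ ‖(fun z : E4 ↦ Minkowski.bilin + ∑ j, (boostedKerrBilin (Λ j t) (E4.ofTimeSpace t (ξ j t)) (M j) (a j) z - Minkowski.bilin)) x v‖) (hν : ‖(fun z : E4 ↦ Minkowski.bilin + ∑ j, (boostedKerrBilin (Λ j t) (E4.ofTimeSpace t (ξ j t)) (M j) (a j) z - Minkowski.bilin)) x‖ ≤ ν)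
    {B δf δv s ε₁ : ℝ} (hB : 0 ≤ B) (hδf0 : 0 ≤ δf) (hδf1 : δf ≤ 1) (hδv0 : 0 ≤ δv) (hδv1 : δv ≤ 1)
    (hs1 : 1 ≤ s)
    (hB1 : ‖fderiv ℝ (fun z : E4 ↦ boostedKerrBilin (Λ i t) (E4.ofTimeSpace t (ξ i t)) (M i) (a i) z) x‖ ≤ B)
    (hB2 : ‖fderiv ℝ (fderiv ℝ (fun z : E4 ↦ boostedKerrBilin (Λ i t) (E4.ofTimeSpace t (ξ i t)) (M i) (a i) z)) x‖ ≤ B)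
    (hBV : ‖(fderiv ℝ (Kerr.bilin (M i) (a i)) (poincareInv (Λ i t) (E4.ofTimeSpace t (ξ i t)) x) (((deriv (fun s ↦ (((Λ i s : E4 ≃L[ℝ] E4).symm : E4 →L[ℝ] E4))) t).comp ((Λ i t : E4 ≃L[ℝ] E4) : E4 →L[ℝ] E4)) (poincareInv (Λ i t) (E4.ofTimeSpace t (ξ i t)) x) + (-((((Λ i t : E4 ≃L[ℝ] E4).symm : E4 →L[ℝ] E4)) (deriv (fun s ↦ E4.ofTimeSpace s (ξ i s)) t))))).bilinearComp (((Λ i t : E4 ≃L[ℝ] E4).symm : E4 →L[ℝ] E4)) (((Λ i t : E4 ≃L[ℝ] E4).symm : E4 →L[ℝ] E4)) + ((Kerr.bilin (M i) (a i)) (poincareInv (Λ i t) (E4.ofTimeSpace t (ξ i t)) x)).bilinearComp (((deriv (fun s ↦ (((Λ i s : E4 ≃L[ℝ] E4).symm : E4 →L[ℝ] E4))) t).comp ((Λ i t : E4 ≃L[ℝ] E4) : E4 →L[ℝ] E4)).comp (((Λ i t : E4 ≃L[ℝ] E4).symm : E4 →L[ℝ] E4))) (((Λ i t : E4 ≃L[ℝ]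 E4).symm : E4 →L[ℝ] E4)) + ((Kerr.bilin (M i) (a i)) (poincareInv (Λ i t) (E4.ofTimeSpace t (ξ i t)) x)).bilinearComp (((Λ i t : E4 ≃L[ℝ] E4).symm : E4 →L[ℝ] E4)) (((deriv (fun s ↦ (((Λ i s : E4 ≃L[ℝ] E4).symm : E4 →L[ℝ] E4))) t).comp ((Λ i t : E4 ≃L[ℝ] E4) : E4 →L[ℝ] E4)).comp (((Λ i t : E4 ≃L[ℝ] E4).symm : E4 →L[ℝ] E4)))‖ + ‖fderiv ℝ (fun z : E4 ↦ (fderiv ℝ (Kerr.bilin (M i) (a i)) (poincareInv (Λ i t) (E4.ofTimeSpace t (ξ i t)) z) (((deriv (fun s ↦ (((Λ i s : E4 ≃L[ℝ] E4).symm : E4 →L[ℝ] E4))) t).comp ((Λ i t : E4 ≃L[ℝ] E4) : E4 →L[ℝ] E4)) (poincareInv (Λ i t) (E4.ofTimeSpace t (ξ i t)) z) + (-((((Λ i t : E4 ≃L[ℝ] E4).symm : E4 →L[ℝ] E4)) (deriv (fun s ↦ E4.ofTimeSpace s (ξ i s)) t))))).bilinearComp (((Λ i t : E4 ≃L[ℝ]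 E4).symm : E4 →L[ℝ] E4)) (((Λ i t : E4 ≃L[ℝ] E4).symm : E4 →L[ℝ] E4)) + ((Kerr.bilin (M i) (a i)) (poincareInv (Λ i t) (E4.ofTimeSpace t (ξ i t)) z)).bilinearComp (((deriv (fun s ↦ (((Λ i s : E4 ≃L[ℝ] E4).symm : E4 →L[ℝ] E4))) t).comp ((Λ i t : E4 ≃L[ℝ] E4) : E4 →L[ℝ] E4)).comp (((Λ i t : E4 ≃L[ℝ] E4).symm : E4 →L[ℝ] E4))) (((Λ i t : E4 ≃L[ℝ] E4).symm : E4 →L[ℝ] E4)) + ((Kerr.bilin (M i) (a i)) (poincareInv (Λ i t) (E4.ofTimeSpace t (ξ i t)) z)).bilinearComp (((Λ i t : E4 ≃L[ℝ] E4).symm : E4 →L[ℝ] E4)) (((deriv (fun s ↦ (((Λ i s : E4 ≃L[ℝ] E4).symm : E4 →L[ℝ] E4))) t).comp ((Λ i t : E4 ≃L[ℝ] E4) : E4 →L[ℝ] E4)).comp (((Λ i t : E4 ≃L[ℝ] E4).symm : E4 →L[ℝ] E4)))) x‖ ≤ B * (‖((deriv (fun s ↦ (((Λ i s : E4 ≃L[ℝ]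 E4).symm : E4 →L[ℝ] E4))) t).comp ((Λ i t : E4 ≃L[ℝ] E4) : E4 →L[ℝ] E4)) (E4.basisVector 0)‖ + ‖E4.spatial (-((((Λ i t : E4 ≃L[ℝ] E4).symm : E4 →L[ℝ] E4)) (deriv (fun s ↦ E4.ofTimeSpace s (ξ i s)) t)))‖ + ‖(a i) • ((deriv (fun s ↦ (((Λ i s : E4 ≃L[ℝ] E4).symm : E4 →L[ℝ] E4))) t).comp ((Λ i t : E4 ≃L[ℝ] E4) : E4 →L[ℝ] E4)) (E4.basisVector 3)‖))
    (hfz : ∀ j, j ≠ i → ∀ k ≤ 2,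
      ‖iteratedFDeriv ℝ k (fun z : E4 ↦ boostedKerrBilin (Λ j t) (E4.ofTimeSpace t (ξ j t)) (M j) (a j) z - Minkowski.bilin) x‖ ≤ δf)
    (hfv : ∀ j, j ≠ i → ‖(fderiv ℝ (Kerr.bilin (M j) (a j)) (poincareInv (Λ j t) (E4.ofTimeSpace t (ξ j t)) x) (((deriv (fun s ↦ (((Λ j s : E4 ≃L[ℝ] E4).symm : E4 →L[ℝ] E4))) t).comp ((Λ j t : E4 ≃L[ℝ] E4) : E4 →L[ℝ] E4)) (poincareInv (Λ j t) (E4.ofTimeSpace t (ξ j t)) x) + (-((((Λ j t : E4 ≃L[ℝ] E4).symm : E4 →L[ℝ] E4)) (deriv (fun s ↦ E4.ofTimeSpace s (ξ j s)) t))))).bilinearComp (((Λ j t : E4 ≃L[ℝ] E4).symm : E4 →L[ℝ] E4)) (((Λ j t : E4 ≃L[ℝ] E4).symm : E4 →L[ℝ] E4)) + ((Kerr.bilin (M j) (a j)) (poincareInv (Λ j t) (E4.ofTimeSpace t (ξ j t)) x)).bilinearComp (((deriv (fun s ↦ (((Λ j s : E4 ≃L[ℝ] E4).symm : E4 →L[ℝ]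 E4))) t).comp ((Λ j t : E4 ≃L[ℝ] E4) : E4 →L[ℝ] E4)).comp (((Λ j t : E4 ≃L[ℝ] E4).symm : E4 →L[ℝ] E4))) (((Λ j t : E4 ≃L[ℝ] E4).symm : E4 →L[ℝ] E4)) + ((Kerr.bilin (M j) (a j)) (poincareInv (Λ j t) (E4.ofTimeSpace t (ξ j t)) x)).bilinearComp (((Λ j t : E4 ≃L[ℝ] E4).symm : E4 →L[ℝ] E4)) (((deriv (fun s ↦ (((Λ j s : E4 ≃L[ℝ] E4).symm : E4 →L[ℝ] E4))) t).comp ((Λ j t : E4 ≃L[ℝ] E4) : E4 →L[ℝ] E4)).comp (((Λ j t : E4 ≃L[ℝ] E4).symm : E4 →L[ℝ] E4)))‖ + ‖fderiv ℝ (fun z : E4 ↦ (fderiv ℝ (Kerr.bilin (M j) (a j)) (poincareInv (Λ j t) (E4.ofTimeSpace t (ξ j t)) z) (((deriv (fun s ↦ (((Λ j s : E4 ≃L[ℝ] E4).symm : E4 →L[ℝ] E4))) t).comp ((Λ j t : E4 ≃L[ℝ] E4) : E4 →L[ℝ] E4)) (poincareInv (Λ j t) (E4.ofTimeSpace t (ξ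 j t)) z) + (-((((Λ j t : E4 ≃L[ℝ] E4).symm : E4 →L[ℝ] E4)) (deriv (fun s ↦ E4.ofTimeSpace s (ξ j s)) t))))).bilinearComp (((Λ j t : E4 ≃L[ℝ] E4).symm : E4 →L[ℝ] E4)) (((Λ j t : E4 ≃L[ℝ] E4).symm : E4 →L[ℝ] E4)) + ((Kerr.bilin (M j) (a j)) (poincareInv (Λ j t) (E4.ofTimeSpace t (ξ j t)) z)).bilinearComp (((deriv (fun s ↦ (((Λ j s : E4 ≃L[ℝ] E4).symm : E4 →L[ℝ] E4))) t).comp ((Λ j t : E4 ≃L[ℝ] E4) : E4 →L[ℝ] E4)).comp (((Λ j t : E4 ≃L[ℝ] E4).symm : E4 →L[ℝ] E4))) (((Λ j t : E4 ≃L[ℝ] E4).symm : E4 →L[ℝ] E4)) + ((Kerr.bilin (M j) (a j)) (poincareInv (Λ j t) (E4.ofTimeSpace t (ξ j t)) z)).bilinearComp (((Λ j t : E4 ≃L[ℝ] E4).symm : E4 →L[ℝ] E4)) (((deriv (fun s ↦ (((Λ j s : E4 ≃L[ℝ] E4).symm : E4 →L[ℝ] E4))) t).comp ((Λ j t : E4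 ≃L[ℝ] E4) : E4 →L[ℝ] E4)).comp (((Λ j t : E4 ≃L[ℝ] E4).symm : E4 →L[ℝ] E4)))) x‖ ≤ δv * (‖((deriv (fun s ↦ (((Λ j s : E4 ≃L[ℝ] E4).symm : E4 →L[ℝ] E4))) t).comp ((Λ j t : E4 ≃L[ℝ] E4) : E4 →L[ℝ] E4)) (E4.basisVector 0)‖ + ‖E4.spatial (-((((Λ j t : E4 ≃L[ℝ] E4).symm : E4 →L[ℝ] E4)) (deriv (fun s ↦ E4.ofTimeSpace s (ξ j s)) t)))‖ + ‖(a j) • ((deriv (fun s ↦ (((Λ j s : E4 ≃L[ℝ] E4).symm : E4 →L[ℝ] E4))) t).comp ((Λ j t : E4 ≃L[ℝ] E4) : E4 →L[ℝ] E4)) (E4.basisVector 3)‖))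
    (hFinv : (boostedKerrBilin (Λ i t) (E4.ofTimeSpace t (ξ i t)) (M i) (a i) x).IsInvertible)
    (hsF : ‖MetricCoord.sharpAt (fun z : E4 ↦ boostedKerrBilin (Λ i t) (E4.ofTimeSpace t (ξ i t)) (M i) (a i) z) x‖ ≤ s)
    (hsG : ‖MetricCoord.sharpAt (fun z : E4 ↦ Minkowski.bilin + ∑ j, (boostedKerrBilin (Λ j t) (E4.ofTimeSpace t (ξ j t)) (M j) (a j) z - Minkowski.bilin)) x‖ ≤ s)
    (hMCL : ∀ l : ℝ, 1 ≤ l → ‖fderiv ℝ (fun z : E4 ↦ Minkowski.bilin + ∑ j, (boostedKerrBilin (Λ j (z 0)) (E4.ofTimeSpace (z 0) (ξ j (z 0))) (M j) (a j) z - Minkowski.bilin)) x‖ ≤ l →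
      (∀ w : E4, w 0 = 0 → ‖fderiv ℝ (fderiv ℝ (fun z : E4 ↦ Minkowski.bilin + ∑ j, (boostedKerrBilin (Λ j (z 0)) (E4.ofTimeSpace (z 0) (ξ j (z 0))) (M j) (a j) z - Minkowski.bilin))) x w‖ ≤ l * ‖w‖) →
      ∀ j : Fin 3, |MetricCoord.ricAt (fun z : E4 ↦ Minkowski.bilin + ∑ j, (boostedKerrBilin (Λ j (z 0)) (E4.ofTimeSpace (z 0) (ξ j (z 0))) (M j) (a j) z - Minkowski.bilin)) x (MetricCoord.sharpAt (fun z : E4 ↦ Minkowski.bilin + ∑ j, (boostedKerrBilin (Λ j (z 0)) (E4.ofTimeSpace (z 0) (ξ j (z 0))) (M j) (a j) z - Minkowski.bilin)) x (E4.dx 0)) (E4.basisVector j.succ)| ≤ ε₁ * l) :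
    ∑ k : Fin 3, |MetricCoord.ricAt (fun z : E4 ↦ (fun z : E4 ↦ Minkowski.bilin + ∑ j, (boostedKerrBilin (Λ j t) (E4.ofTimeSpace t (ξ j t)) (M j) (a j) z - Minkowski.bilin)) z + ((E4.dx 0) z - t) • ((fderiv ℝ (Kerr.bilin (M i) (a i)) (poincareInv (Λ i t) (E4.ofTimeSpace t (ξ i t)) z) (((deriv (fun s ↦ (((Λ i s : E4 ≃L[ℝ] E4).symm : E4 →L[ℝ] E4))) t).comp ((Λ i t : E4 ≃L[ℝ] E4) : E4 →L[ℝ] E4)) (poincareInv (Λ i t) (E4.ofTimeSpace t (ξ i t)) z) + (-((((Λ i t : E4 ≃L[ℝ] E4).symm : E4 →L[ℝ] E4)) (deriv (fun s ↦ E4.ofTimeSpace s (ξ i s)) t))))).bilinearComp (((Λ i t : E4 ≃L[ℝ] E4).symm : E4 →L[ℝ] E4)) (((Λ i t : E4 ≃L[ℝ] E4).symm : E4 →L[ℝ] E4)) + ((Kerr.bilin (M i) (a i)) (poincareInv (Λ i t) (E4.ofTimeSpace t (ξ i t)) z)).bilinearComp (((deriv (fun s ↦ (((Λ i s : E4 ≃L[ℝ]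 E4).symm : E4 →L[ℝ] E4))) t).comp ((Λ i t : E4 ≃L[ℝ] E4) : E4 →L[ℝ] E4)).comp (((Λ i t : E4 ≃L[ℝ] E4).symm : E4 →L[ℝ] E4))) (((Λ i t : E4 ≃L[ℝ] E4).symm : E4 →L[ℝ] E4)) + ((Kerr.bilin (M i) (a i)) (poincareInv (Λ i t) (E4.ofTimeSpace t (ξ i t)) z)).bilinearComp (((Λ i t : E4 ≃L[ℝ] E4).symm : E4 →L[ℝ] E4)) (((deriv (fun s ↦ (((Λ i s : E4 ≃L[ℝ] E4).symm : E4 →L[ℝ] E4))) t).comp ((Λ i t : E4 ≃L[ℝ] E4) : E4 →L[ℝ] E4)).comp (((Λ i t : E4 ≃L[ℝ] E4).symm : E4 →L[ℝ] E4))))) x (MetricCoord.sharpAt (fun z : E4 ↦ Minkowski.bilin + ∑ j, (boostedKerrBilin (Λ j t) (E4.ofTimeSpace t (ξ j t)) (M j) (a j) z - Minkowski.bilin)) x (E4.dx 0)) (E4.basisVector k.succ) - MetricCoord.ricAt (fun z : E4 ↦ Minkowski.bilin + ∑ j, (boostedKerrBilin (Λ j t) (E4.ofTimeSpace t (ξ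 j t)) (M j) (a j) z - Minkowski.bilin)) x (MetricCoord.sharpAt (fun z : E4 ↦ Minkowski.bilin + ∑ j, (boostedKerrBilin (Λ j t) (E4.ofTimeSpace t (ξ j t)) (M j) (a j) z - Minkowski.bilin)) x (E4.dx 0)) (E4.basisVector k.succ)| ≤
      3 * (ε₁ * ((B + N + 1) * (1 + ∑ j, (‖((deriv (fun s ↦ (((Λ j s : E4 ≃L[ℝ] E4).symm : E4 →L[ℝ] E4))) t).comp ((Λ j t : E4 ≃L[ℝ] E4) : E4 →L[ℝ] E4)) (E4.basisVector 0)‖ + ‖E4.spatial (-((((Λ j t : E4 ≃L[ℝ] E4).symm : E4 →L[ℝ] E4)) (deriv (fun s ↦ E4.ofTimeSpace s (ξ j s)) t)))‖ + ‖(a j) • ((deriv (fun s ↦ (((Λ j s : E4 ≃L[ℝ] E4).symm : E4 →L[ℝ] E4))) t).comp ((Λ j t : E4 ≃L[ℝ] E4) : E4 →L[ℝ] E4)) (E4.basisVector 3)‖))) +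
        (12 * (s ^ 3 * (5 * (B + 2 * N) ^ 2 + (B + 2 * N)) + 5 * s ^ 2 * (B + 2 * N) + s) * N) * δf * s +
        (max C 0 * (1 + (B + N))) * δv * ∑ j, (‖((deriv (fun s ↦ (((Λ j s : E4 ≃L[ℝ] E4).symm : E4 →L[ℝ] E4))) t).comp ((Λ j t : E4 ≃L[ℝ] E4) : E4 →L[ℝ] E4)) (E4.basisVector 0)‖ + ‖E4.spatial (-((((Λ j t : E4 ≃L[ℝ] E4).symm : E4 →L[ℝ] E4)) (deriv (fun s ↦ E4.ofTimeSpace s (ξ j s)) t)))‖ + ‖(a j) • ((deriv (fun s ↦ (((Λ j s : E4 ≃L[ℝ] E4).symm : E4 →L[ℝ] E4))) t).comp ((Λ j t : E4 ≃L[ℝ] E4) : E4 →L[ℝ] E4)) (E4.basisVector 3)‖)) := by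
  classical
  set Gt : E4 → E4 →L[ℝ] E4 →L[ℝ] ℝ := (fun z : E4 ↦ Minkowski.bilin + ∑ j, (boostedKerrBilin (Λ j t) (E4.ofTimeSpace t (ξ j t)) (M j) (a j) z - Minkowski.bilin)) with hGt
  set H : E4 → E4 →L[ℝ] E4 →L[ℝ] ℝ := (fun z : E4 ↦ Minkowski.bilin + ∑ j, (boostedKerrBilin (Λ j (z 0)) (E4.ofTimeSpace (z 0) (ξ j (z 0))) (M j) (a j) z - Minkowski.bilin)) with hH
  set Vl : Fin N → E4 → E4 →L[ℝ] E4 →L[ℝ] ℝ := fun j z ↦ (fderiv ℝ (Kerr.bilin (M j) (a j)) (poincareInv (Λ j t) (E4.ofTimeSpace t (ξ j t)) z) (((deriv (fun s ↦ (((Λ j s : E4 ≃L[ℝ] E4).symm : E4 →L[ℝ] E4))) t).comp ((Λ j t : E4 ≃L[ℝ] E4) : E4 →L[ℝ] E4)) (poincareInv (Λ j t) (E4.ofTimeSpace t (ξ j t)) z) + (-((((Λ j t : E4 ≃L[ℝ] E4).symm : E4 →L[ℝ] E4)) (deriv (fun s ↦ E4.ofTimeSpace s (ξ j s)) t))))).bilinearComp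 (((Λ j t : E4 ≃L[ℝ] E4).symm : E4 →L[ℝ] E4)) (((Λ j t : E4 ≃L[ℝ] E4).symm : E4 →L[ℝ] E4)) + ((Kerr.bilin (M j) (a j)) (poincareInv (Λ j t) (E4.ofTimeSpace t (ξ j t)) z)).bilinearComp (((deriv (fun s ↦ (((Λ j s : E4 ≃L[ℝ] E4).symm : E4 →L[ℝ] E4))) t).comp ((Λ j t : E4 ≃L[ℝ] E4) : E4 →L[ℝ] E4)).comp (((Λ j t : E4 ≃L[ℝ] E4).symm : E4 →L[ℝ] E4))) (((Λ j t : E4 ≃L[ℝ] E4).symm : E4 →L[ℝ] E4)) + ((Kerr.bilin (M j) (a j)) (poincareInv (Λ j t) (E4.ofTimeSpace t (ξ j t)) z)).bilinearComp (((Λ j t : E4 ≃L[ℝ] E4).symm : E4 →L[ℝ] E4)) (((deriv (fun s ↦ (((Λ j s : E4 ≃L[ℝ] E4).symm : E4 →L[ℝ] E4))) t).comp ((Λ j t : E4 ≃L[ℝ] E4) : E4 →L[ℝ] E4)).comp (((Λ j t : E4 ≃L[ℝ] E4).symm : E4 →L[ℝ] E4))) with hVl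
  set red : Fin N → ℝ := fun j ↦ (‖((deriv (fun s ↦ (((Λ j s : E4 ≃L[ℝ] E4).symm : E4 →L[ℝ] E4))) t).comp ((Λ j t : E4 ≃L[ℝ] E4) : E4 →L[ℝ] E4)) (E4.basisVector 0)‖ + ‖E4.spatial (-((((Λ j t : E4 ≃L[ℝ] E4).symm : E4 →L[ℝ] E4)) (deriv (fun s ↦ E4.ofTimeSpace s (ξ j s)) t)))‖ + ‖(a j) • ((deriv (fun s ↦ (((Λ j s : E4 ≃L[ℝ] E4).symm : E4 →L[ℝ] E4))) t).comp ((Λ j t : E4 ≃L[ℝ] E4) : E4 →L[ℝ] E4)) (E4.basisVector 3)‖) with hred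
  set Fr : Fin N → E4 → E4 →L[ℝ] E4 →L[ℝ] ℝ := fun j z ↦ boostedKerrBilin (Λ j t) (E4.ofTimeSpace t (ξ j t)) (M j) (a j) z with hFr
  set n : E4 →L[ℝ] ℝ := E4.dx 0 with hn
  set R : ℝ := ∑ j, red j with hR
  have hx0' : n x = t := hx0
  have hred0 : ∀ j, 0 ≤ red j := fun j ↦ by simp only [hred]; positivity
  have hR0 : 0 ≤ R := Finset.sum_nonneg fun j _ ↦ hred0 j
  have hN0 : (0 : ℝ) ≤ N := Nat.cast_nonneg N
  have hne : ∀ k : Fin 3, n (E4.basisVector k.succ) = 0 := fun k ↦ by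
    simp [hn, Fin.succ_ne_zero]
  have hB1' : ‖fderiv ℝ (Fr i) x‖ ≤ B := hB1
  have hB2' : ‖fderiv ℝ (fderiv ℝ (Fr i)) x‖ ≤ B := hB2
  have hBV' : ‖Vl i x‖ + ‖fderiv ℝ (Vl i) x‖ ≤ B * red i := hBV
  have hfv' : ∀ j, j ≠ i → ‖Vl j x‖ + ‖fderiv ℝ (Vl j) x‖ ≤ δv * red j := hfv
  have hfz' : ∀ j, j ≠ i → ∀ k ≤ 2, ‖iteratedFDeriv ℝ k (fun z ↦ Fr j z - Minkowski.bilin) x‖ ≤ δf := hfz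
  set U : Set E4 := {z : E4 | ∀ j, 0 < Kerr.radius (a j) (poincareInv (Λ j t) (E4.ofTimeSpace t (ξ j t)) z)}
    with hUdef
  have hUo : IsOpen U := firstOrder_isOpen_frozenDomain a Λ ξ t
  have hxU : x ∈ U := hU
  have hGsm : ∀ z ∈ U, ContDiffAt ℝ ((⊤ : ℕ∞) : WithTop ℕ∞) Gt z := fun z hz ↦
    firstOrder_contDiffAt_frozen M hz
  have hGsy : ∀ z v w, Gt z v w = Gt z w v := fun z v w ↦ firstOrder_frozen_symm M a Λ ξ t z v w
  have hVsm : ∀ j, ∀ z ∈ U, ContDiffAt ℝ ((⊤ : ℕ∞) : WithTop ℕ∞) (Vl j) z := fun j z hz ↦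
    firstOrder_contDiffAt_variation (Λ j t) _ _ _ (M j) (a j) (hz j)
  have hVsy : ∀ j z v w, Vl j z v w = Vl j z w v := fun j z v w ↦
    firstOrder_variation_symm (Λ j t) _ _ _ (M j) (a j) z v w
  -- sizes of the frozen jets at `x`
  have h2f : ∀ j ∈ (Finset.univ : Finset (Fin N)), ContDiffAt ℝ 2 (Fr j) x := fun j _ ↦
    contDiffAt_boostedKerrBilin (Λ j t) _ (M j) (a j) (hU j)
  obtain ⟨hs1f, hs2f⟩ := firstOrder_jets_const_add_sum Finset.univ (Minkowski.bilin : E4 →L[ℝ] E4 →L[ℝ] ℝ) h2f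
  have hDG1 : fderiv ℝ Gt x = fderiv ℝ (Fr i) x + ∑ j ∈ Finset.univ.erase i, fderiv ℝ (Fr j) x := by
    rw [hGt, hs1f, ← Finset.add_sum_erase _ _ (Finset.mem_univ i)]
  have hDG2 : fderiv ℝ (fderiv ℝ Gt) x = fderiv ℝ (fderiv ℝ (Fr i)) x +
      ∑ j ∈ Finset.univ.erase i, fderiv ℝ (fderiv ℝ (Fr j)) x := by
    have e1 : fderiv ℝ (fderiv ℝ Gt) x = ∑ j, fderiv ℝ (fderiv ℝ (Fr j)) x := by
      refine ContinuousLinearMap.ext fun v ↦ ?_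
      rw [sum_apply]
      exact hs2f v
    rw [e1, ← Finset.add_sum_erase _ _ (Finset.mem_univ i)]
  have hfz1 : ∀ j, j ≠ i → ‖fderiv ℝ (Fr j) x‖ ≤ δf := fun j hj ↦ by
    have h := hfz' j hj 1 (by norm_num)
    rwa [← (norm_fderiv_eq_norm_iteratedFDeriv _ x).1, fderiv_sub_const] at h
  have hfz2 : ∀ j, j ≠ i → ‖fderiv ℝ (fderiv ℝ (Fr j)) x‖ ≤ δf := fun j hj ↦ by
    have h := hfz' j hj 2 le_rfl
    have e : fderiv ℝ (fun z : E4 ↦ Fr j z - Minkowski.bilin) = fderiv ℝ (Fr j) :=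
      funext fun z ↦ fderiv_sub_const _
    rwa [← (norm_fderiv_eq_norm_iteratedFDeriv _ x).2, e] at h
  have hfz0 : ∀ j, j ≠ i → ‖Fr j x - Minkowski.bilin‖ ≤ δf := fun j hj ↦ by
    have h := hfz' j hj 0 (by norm_num)
    rwa [norm_iteratedFDeriv_zero] at h
  have hNδ : (N : ℝ) * δf ≤ N := by nlinarith
  have hS1 : ‖∑ j ∈ Finset.univ.erase i, fderiv ℝ (Fr j) x‖ ≤ N :=
    (firstOrder_norm_sum_erase_le (fun j ↦ fderiv ℝ (Fr j) x) i hδf0 hfz1).trans hNδ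
  have hS2 : ‖∑ j ∈ Finset.univ.erase i, fderiv ℝ (fderiv ℝ (Fr j)) x‖ ≤ N :=
    (firstOrder_norm_sum_erase_le (fun j ↦ fderiv ℝ (fderiv ℝ (Fr j)) x) i hδf0 hfz2).trans hNδ
  have nDG1 : ‖fderiv ℝ Gt x‖ ≤ B + N := by
    rw [hDG1]
    calc _ ≤ ‖fderiv ℝ (Fr i) x‖ + ‖∑ j ∈ Finset.univ.erase i, fderiv ℝ (Fr j) x‖ := norm_add_le _ _
      _ ≤ B + N := add_le_add hB1' hS1
  have nDG2 : ‖fderiv ℝ (fderiv ℝ Gt) x‖ ≤ B + N := by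
    rw [hDG2]
    calc _ ≤ ‖fderiv ℝ (fderiv ℝ (Fr i)) x‖ + ‖∑ j ∈ Finset.univ.erase i, fderiv ℝ (fderiv ℝ (Fr j)) x‖ :=
          norm_add_le _ _
      _ ≤ B + N := add_le_add hB2' hS2
  -- sizes of the variation fields at `x`
  have hVsum : ∑ j, ‖Vl j x‖ ≤ (B + 1) * R ∧ ∑ j, ‖fderiv ℝ (Vl j) x‖ ≤ (B + 1) * R := by
    have h1 : ∀ j, ‖Vl j x‖ + ‖fderiv ℝ (Vl j) x‖ ≤ (B + 1) * red j := by
      intro j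
      by_cases hj : j = i
      · subst hj
        calc _ ≤ B * red j := hBV'
          _ ≤ (B + 1) * red j := by nlinarith [hred0 j]
      · calc _ ≤ δv * red j := hfv' j hj
          _ ≤ (B + 1) * red j := by nlinarith [hred0 j]
    have hs : ∑ j, (B + 1) * red j = (B + 1) * R := by rw [hR, Finset.mul_sum]
    exact ⟨(Finset.sum_le_sum fun j _ ↦ le_trans (le_add_of_nonneg_right (norm_nonneg _)) (h1 j)).trans hs.le,
      (Finset.sum_le_sum fun j _ ↦ le_trans (le_add_of_nonneg_left (norm_nonneg _)) (h1 j)).trans hs.le⟩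
  -- (1) the rows split over the holes
  have hsplit : ∀ k : Fin 3,
      MetricCoord.ricAt (fun z ↦ Gt z + (n z - t) • ∑ j ∈ Finset.univ, Vl j z) x (MetricCoord.sharpAt Gt x n)
          (E4.basisVector k.succ) - MetricCoord.ricAt Gt x (MetricCoord.sharpAt Gt x n) (E4.basisVector k.succ) =
      ∑ j ∈ Finset.univ, (MetricCoord.ricAt (fun z ↦ Gt z + (n z - t) • ∑ j' ∈ ({j} : Finset (Fin N)), Vl j' z) x
          (MetricCoord.sharpAt Gt x n) (E4.basisVector k.succ) -
        MetricCoord.ricAt Gt x (MetricCoord.sharpAt Gt x n) (E4.basisVector k.succ)) := fun k ↦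
    firstOrder_rows_split ML₁ hUo hxU hx0' hGsm hGsy hVsm hVsy hμ hcoer Finset.univ (hne k)
  -- (2) the far rows are small
  obtain ⟨hn1, -⟩ := firstOrder_norm_dx_basis 0
  have hfar : ∀ j, j ≠ i → ∀ k : Fin 3,
      |MetricCoord.ricAt (fun z ↦ Gt z + (n z - t) • ∑ j' ∈ ({j} : Finset (Fin N)), Vl j' z) x
          (MetricCoord.sharpAt Gt x n) (E4.basisVector k.succ) -
        MetricCoord.ricAt Gt x (MetricCoord.sharpAt Gt x n) (E4.basisVector k.succ)| ≤
      max C 0 * (1 + (B + N)) * (δv * red j) := by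
    intro j hj k
    have h := firstOrder_rows_far (G := Gt) (U := U) (x := x) (t := t) (C := C) (μ := μ) (ν := ν) ML₂
      (V₁ := Vl j) hUo hxU hx0' hGsm hGsy (hVsm j) (hVsy j) hμ hcoer hν (hne k)
    simp only [Finset.sum_singleton]
    refine h.trans ?_
    obtain ⟨-, hek⟩ := firstOrder_norm_dx_basis k
    rw [hek, mul_one]
    have hC : C * (1 + ‖fderiv ℝ Gt x‖) * (‖Vl j x‖ + ‖fderiv ℝ (Vl j) x‖) * ‖n‖ ^ 2 ≤
        max C 0 * (1 + ‖fderiv ℝ Gt x‖) * (‖Vl j x‖ + ‖fderiv ℝ (Vl j) x‖) * ‖n‖ ^ 2 := by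
      have : 0 ≤ (1 + ‖fderiv ℝ Gt x‖) * (‖Vl j x‖ + ‖fderiv ℝ (Vl j) x‖) * ‖n‖ ^ 2 := by positivity
      nlinarith [le_max_left C 0]
    refine hC.trans ?_
    have hn2 : ‖n‖ ^ 2 ≤ 1 := by
      rw [hn]; nlinarith [norm_nonneg (E4.dx 0 : E4 →L[ℝ] ℝ)]
    calc max C 0 * (1 + ‖fderiv ℝ Gt x‖) * (‖Vl j x‖ + ‖fderiv ℝ (Vl j) x‖) * ‖n‖ ^ 2
        ≤ max C 0 * (1 + (B + N)) * (δv * red j) * 1 := by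
          refine mul_le_mul (mul_le_mul (mul_le_mul_of_nonneg_left (by linarith) (le_max_right _ _))
            (hfv' j hj) (by positivity) (by positivity)) hn2 (by positivity) (by positivity)
      _ = _ := by ring
  -- (3) the painted ansatz has the rows of `G_univ`
  have hUm : IsOpen {z : E4 | ∀ j, 0 < Kerr.radius (a j)
      (poincareInv (Λ j (z 0)) (E4.ofTimeSpace (z 0) (ξ j (z 0))) z)} := firstOrder_isOpen_movingDomain a hsm
  have hxUm : x ∈ {z : E4 | ∀ j, 0 < Kerr.radius (a j)
      (poincareInv (Λ j (z 0)) (E4.ofTimeSpace (z 0) (ξ j (z 0))) z)} := by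
    intro j; rw [hx0]; exact hU j
  have hHsm : ∀ z ∈ {z : E4 | ∀ j, 0 < Kerr.radius (a j)
      (poincareInv (Λ j (z 0)) (E4.ofTimeSpace (z 0) (ξ j (z 0))) z)},
      ContDiffAt ℝ ((⊤ : ℕ∞) : WithTop ℕ∞) H z := fun z hz ↦
    contDiffAt_ansatzBilin' N M a Λ ξ (fun j ↦ (hsm j).2) (fun j ↦ (hsm j).1) z hz
  have hHsy : ∀ z v w, H z v w = H z w v := fun z v w ↦ by
    simp only [hH]
    exact firstOrder_frozen_symm M a Λ ξ (z 0) z v w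
  obtain ⟨W, hj0, hj1, hj2⟩ := firstOrder_ansatz_sliceJet (M := M) (a := a) hsm hx0 hU
  have hj0' : H x = Gt x := hj0
  have hj1' : fderiv ℝ H x = fderiv ℝ Gt x + n.smulRight (∑ j, Vl j x) := hj1
  have hj2' : ∀ v, fderiv ℝ (fderiv ℝ H) x v = fderiv ℝ (fderiv ℝ Gt) x v +
      (n v • ∑ j, fderiv ℝ (Vl j) x + n.smulRight ((∑ j, fderiv ℝ (Vl j) x) v) + n v • n.smulRight W) := hj2
  have hinvis : ∀ k : Fin 3, MetricCoord.ricAt H x (MetricCoord.sharpAt Gt x n) (E4.basisVector k.succ) =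
      MetricCoord.ricAt (fun z ↦ Gt z + (n z - t) • ∑ j ∈ Finset.univ, Vl j z) x (MetricCoord.sharpAt Gt x n)
        (E4.basisVector k.succ) := fun k ↦
    firstOrder_rows_invisible (V := Vl) hUo hxU hx0' hGsm hGsy hVsm hVsy hμ hcoer hUm hxUm hHsm hHsy
      hj0' hj1' hj2' (hne k)
  -- (4) the momentum clause at `x`
  set l : ℝ := (B + N + 1) * (1 + R) with hl
  have hl1 : 1 ≤ l := by rw [hl]; nlinarith
  have hJ1 : ‖fderiv ℝ H x‖ ≤ l := by
    rw [hj1']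
    have h2 : ‖n.smulRight (∑ j, Vl j x)‖ ≤ ∑ j, ‖Vl j x‖ := by
      rw [ContinuousLinearMap.norm_smulRight_apply]
      calc ‖n‖ * ‖∑ j, Vl j x‖ ≤ 1 * ∑ j, ‖Vl j x‖ :=
            mul_le_mul hn1 (norm_sum_le _ _) (norm_nonneg _) zero_le_one
        _ = _ := one_mul _
    have h3 : ‖fderiv ℝ Gt x + n.smulRight (∑ j, Vl j x)‖ ≤ (B + N) + (B + 1) * R :=
      norm_add_le_of_le nDG1 (h2.trans hVsum.1)
    refine h3.trans ?_
    rw [hl]; nlinarith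
  have hJ2 : ∀ w : E4, w 0 = 0 → ‖fderiv ℝ (fderiv ℝ H) x w‖ ≤ l * ‖w‖ := by
    intro w hw
    have hnw : n w = 0 := hw
    rw [hj2' w]
    have hz1 : ‖n w • ∑ j, fderiv ℝ (Vl j) x‖ = 0 := by rw [norm_smul, hnw, norm_zero, zero_mul]
    have hz2 : ‖n w • n.smulRight W‖ = 0 := by rw [norm_smul, hnw, norm_zero, zero_mul]
    have hsplit3 : ‖fderiv ℝ (fderiv ℝ Gt) x w + (n w • ∑ j, fderiv ℝ (Vl j) x +
        n.smulRight ((∑ j, fderiv ℝ (Vl j) x) w) + n w • n.smulRight W)‖ ≤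
        ‖fderiv ℝ (fderiv ℝ Gt) x w‖ + ‖n.smulRight ((∑ j, fderiv ℝ (Vl j) x) w)‖ := by
      have t1 := norm_add_le (fderiv ℝ (fderiv ℝ Gt) x w) (n w • ∑ j, fderiv ℝ (Vl j) x +
        n.smulRight ((∑ j, fderiv ℝ (Vl j) x) w) + n w • n.smulRight W)
      have t2 := norm_add₃_le (a := n w • ∑ j, fderiv ℝ (Vl j) x)
        (b := n.smulRight ((∑ j, fderiv ℝ (Vl j) x) w)) (c := n w • n.smulRight W)
      linarith
    refine hsplit3.trans ?_
    have h1 : ‖fderiv ℝ (fderiv ℝ Gt) x w‖ ≤ (B + N) * ‖w‖ :=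
      (ContinuousLinearMap.le_opNorm _ _).trans (mul_le_mul_of_nonneg_right nDG2 (norm_nonneg _))
    have h2 : ‖n.smulRight ((∑ j, fderiv ℝ (Vl j) x) w)‖ ≤ (B + 1) * R * ‖w‖ := by
      rw [ContinuousLinearMap.norm_smulRight_apply]
      have h4 : ‖(∑ j, fderiv ℝ (Vl j) x) w‖ ≤ (B + 1) * R * ‖w‖ :=
        calc ‖(∑ j, fderiv ℝ (Vl j) x) w‖ ≤ ‖∑ j, fderiv ℝ (Vl j) x‖ * ‖w‖ := ContinuousLinearMap.le_opNorm _ _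
          _ ≤ (∑ j, ‖fderiv ℝ (Vl j) x‖) * ‖w‖ := mul_le_mul_of_nonneg_right (norm_sum_le _ _) (norm_nonneg _)
          _ ≤ (B + 1) * R * ‖w‖ := mul_le_mul_of_nonneg_right hVsum.2 (norm_nonneg _)
      calc ‖n‖ * ‖(∑ j, fderiv ℝ (Vl j) x) w‖ ≤ 1 * ((B + 1) * R * ‖w‖) :=
            mul_le_mul hn1 h4 (norm_nonneg _) zero_le_one
        _ = _ := one_mul _
    have hw0 := norm_nonneg w
    have h3 : (B + N) + (B + 1) * R ≤ (B + N + 1) * (1 + R) := by nlinarith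
    calc _ ≤ (B + N) * ‖w‖ + (B + 1) * R * ‖w‖ := add_le_add h1 h2
      _ = ((B + N) + (B + 1) * R) * ‖w‖ := by ring
      _ ≤ ((B + N + 1) * (1 + R)) * ‖w‖ := mul_le_mul_of_nonneg_right h3 hw0
      _ = l * ‖w‖ := by rw [hl]
  have hsharpH : MetricCoord.sharpAt H x n = MetricCoord.sharpAt Gt x n := by
    unfold MetricCoord.sharpAt
    rw [hj0']
  have hrowsH : ∀ k : Fin 3, |MetricCoord.ricAt H x (MetricCoord.sharpAt Gt x n) (E4.basisVector k.succ)| ≤ ε₁ * l := by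
    intro k
    rw [← hsharpH]
    exact hMCL l hl1 hJ1 hJ2 k
  -- (5) the rows of the frozen background are small
  have hrowsG : ∀ k : Fin 3, |MetricCoord.ricAt Gt x (MetricCoord.sharpAt Gt x n) (E4.basisVector k.succ)| ≤
      (12 * (s ^ 3 * (5 * (B + 2 * N) ^ 2 + (B + 2 * N)) + 5 * s ^ 2 * (B + 2 * N) + s) * N) * δf * s := by
    intro k
    -- the own summand and the frozen background on a common open set
    set Ui : Set E4 := {z : E4 | 0 < Kerr.radius (a i) (poincareInv (Λ i t) (E4.ofTimeSpace t (ξ i t)) z)} with hUi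
    have hUio : IsOpen Ui :=
      isOpen_lt continuous_const ((Kerr.continuous_radius _).comp (continuous_poincareInv _ _))
    have hFsm : ∀ z ∈ Ui, ContDiffAt ℝ ((⊤ : ℕ∞) : WithTop ℕ∞) (Fr i) z := fun z hz ↦
      contDiffAt_boostedKerrBilin (Λ i t) _ (M i) (a i) hz
    have hFsy : ∀ z v w, Fr i z v w = Fr i z w v := fun z v w ↦ by
      simp only [hFr, boostedKerrBilin_apply]
      exact Kerr.bilin_symm _ _ _ _ _
    have mF := firstOrder_isMetricOn_of hUio hFsm hFsy
    have mG := firstOrder_isMetricOn_of hUo hGsm hGsy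
    have hinvG : (Gt x).IsInvertible := firstOrder_isInvertible_of_coercive hμ hcoer
    set Wc : Set E4 := (Ui ∩ {z | (Fr i z).IsInvertible}) ∩ (U ∩ {z | (Gt z).IsInvertible}) with hWc
    have hWo : IsOpen Wc := mF.isOpen.inter mG.isOpen
    have hxW : x ∈ Wc := ⟨⟨hU i, hFinv⟩, hxU, hinvG⟩
    have mF' : MetricCoord.IsMetricOn (Fr i) Wc := firstOrder_isMetricOn_subset mF hWo fun z hz ↦ hz.1
    have mG' : MetricCoord.IsMetricOn Gt Wc := firstOrder_isMetricOn_subset mG hWo fun z hz ↦ hz.2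
    have hRic0 : MetricCoord.ricAt (Fr i) x = 0 := by
      ext Y Z
      exact ricAt_boostedKerrBilin (Λ i t) _ (M i) (a i) (hU i) Y Z
    have hpert := abs_ricAt_le_of_ricAt_eq_zero_jet mF' mG' hxW hRic0 hs1 hsF hsG
      (MetricCoord.sharpAt Gt x n) (E4.basisVector k.succ)
    refine hpert.trans ?_
    -- the jet differences
    have hGtx : Gt x = Minkowski.bilin + ∑ j, (Fr j x - Minkowski.bilin) := rfl
    have hd0 : ‖Fr i x - Gt x‖ ≤ N * δf := by
      have e : Gt x - Fr i x = ∑ j ∈ Finset.univ.erase i, (Fr j x - Minkowski.bilin) := by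
        rw [hGtx]; exact firstOrder_sum_sub_own (fun j ↦ Fr j x) Minkowski.bilin i
      calc ‖Fr i x - Gt x‖ = ‖Gt x - Fr i x‖ := norm_sub_rev _ _
        _ = ‖∑ j ∈ Finset.univ.erase i, (Fr j x - Minkowski.bilin)‖ := by rw [e]
        _ ≤ N * δf := firstOrder_norm_sum_erase_le (fun j ↦ Fr j x - Minkowski.bilin) i hδf0 hfz0
    have hd1 : ‖fderiv ℝ (Fr i) x - fderiv ℝ Gt x‖ ≤ N * δf := by
      have e : fderiv ℝ Gt x - fderiv ℝ (Fr i) x = ∑ j ∈ Finset.univ.erase i, fderiv ℝ (Fr j) x := by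
        rw [hDG1]; abel
      calc ‖fderiv ℝ (Fr i) x - fderiv ℝ Gt x‖ = ‖fderiv ℝ Gt x - fderiv ℝ (Fr i) x‖ := norm_sub_rev _ _
        _ = ‖∑ j ∈ Finset.univ.erase i, fderiv ℝ (Fr j) x‖ := by rw [e]
        _ ≤ N * δf := firstOrder_norm_sum_erase_le (fun j ↦ fderiv ℝ (Fr j) x) i hδf0 hfz1
    have hd2 : ‖fderiv ℝ (fderiv ℝ (Fr i)) x - fderiv ℝ (fderiv ℝ Gt) x‖ ≤ N * δf := by
      have e : fderiv ℝ (fderiv ℝ Gt) x - fderiv ℝ (fderiv ℝ (Fr i)) x =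
          ∑ j ∈ Finset.univ.erase i, fderiv ℝ (fderiv ℝ (Fr j)) x := by
        rw [hDG2]; abel
      calc ‖fderiv ℝ (fderiv ℝ (Fr i)) x - fderiv ℝ (fderiv ℝ Gt) x‖ =
          ‖fderiv ℝ (fderiv ℝ Gt) x - fderiv ℝ (fderiv ℝ (Fr i)) x‖ := norm_sub_rev _ _
        _ = ‖∑ j ∈ Finset.univ.erase i, fderiv ℝ (fderiv ℝ (Fr j)) x‖ := by rw [e]
        _ ≤ N * δf := firstOrder_norm_sum_erase_le (fun j ↦ fderiv ℝ (fderiv ℝ (Fr j)) x) i hδf0 hfz2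
    have hn₁ : ‖fderiv ℝ Gt x‖ + ‖fderiv ℝ (Fr i) x - fderiv ℝ Gt x‖ ≤ B + 2 * N := by
      linarith [hd1.trans hNδ]
    have hn₂ : ‖fderiv ℝ (fderiv ℝ Gt) x‖ + ‖fderiv ℝ (fderiv ℝ (Fr i)) x - fderiv ℝ (fderiv ℝ Gt) x‖ ≤ B + 2 * N := by
      linarith [hd2.trans hNδ]
    have harith := firstOrder_pert_arith hs1 hB hN0 (by positivity) hn₁ hn₂
      (norm_nonneg _) (norm_nonneg _) hd0 hd1 hd2
    have hfin : (Module.finrank ℝ E4 : ℝ) = 4 := by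
      rw [finrank_euclideanSpace_fin]; norm_num
    have hY : ‖MetricCoord.sharpAt Gt x n‖ ≤ s := by
      calc ‖MetricCoord.sharpAt Gt x n‖ ≤ ‖MetricCoord.sharpAt Gt x‖ * ‖n‖ := ContinuousLinearMap.le_opNorm _ _
        _ ≤ s * 1 := mul_le_mul hsG hn1 (norm_nonneg _) (zero_le_one.trans hs1)
        _ = s := mul_one s
    obtain ⟨-, hek⟩ := firstOrder_norm_dx_basis k
    rw [hfin, hek, mul_one]
    set Φ : ℝ := s ^ 3 * (5 * (‖fderiv ℝ Gt x‖ + ‖fderiv ℝ (Fr i) x - fderiv ℝ Gt x‖) ^ 2 +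
        (‖fderiv ℝ (fderiv ℝ Gt) x‖ + ‖fderiv ℝ (fderiv ℝ (Fr i)) x - fderiv ℝ (fderiv ℝ Gt) x‖)) *
        ‖Fr i x - Gt x‖ +
      5 * s ^ 2 * (‖fderiv ℝ Gt x‖ + ‖fderiv ℝ (Fr i) x - fderiv ℝ Gt x‖) * ‖fderiv ℝ (Fr i) x - fderiv ℝ Gt x‖ +
      s * ‖fderiv ℝ (fderiv ℝ (Fr i)) x - fderiv ℝ (fderiv ℝ Gt) x‖ with hΦ
    set Ψ : ℝ := (s ^ 3 * (5 * (B + 2 * N) ^ 2 + (B + 2 * N)) + 5 * s ^ 2 * (B + 2 * N) + s) * (N * δf) with hΨ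
    have hΦΨ : Φ ≤ Ψ := harith
    have hΦ0 : 0 ≤ Φ := by rw [hΦ]; positivity
    calc 3 * (4 : ℝ) * Φ * ‖MetricCoord.sharpAt Gt x n‖ ≤ 3 * 4 * Ψ * s :=
          mul_le_mul (mul_le_mul_of_nonneg_left hΦΨ (by norm_num)) hY (norm_nonneg _) (by rw [hΨ]; positivity)
      _ = _ := by rw [hΨ]; ring
  -- (6) combine
  have hown : ∀ k : Fin 3,
      |MetricCoord.ricAt (fun z ↦ Gt z + (n z - t) • ∑ j' ∈ ({i} : Finset (Fin N)), Vl j' z) x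
          (MetricCoord.sharpAt Gt x n) (E4.basisVector k.succ) -
        MetricCoord.ricAt Gt x (MetricCoord.sharpAt Gt x n) (E4.basisVector k.succ)| ≤
      ε₁ * l + (12 * (s ^ 3 * (5 * (B + 2 * N) ^ 2 + (B + 2 * N)) + 5 * s ^ 2 * (B + 2 * N) + s) * N) * δf * s +
        max C 0 * (1 + (B + N)) * δv * R := by
    intro k
    set row : Fin N → ℝ := fun j ↦ MetricCoord.ricAt (fun z ↦ Gt z + (n z - t) • ∑ j' ∈ ({j} : Finset (Fin N)), Vl j' z) x
        (MetricCoord.sharpAt Gt x n) (E4.basisVector k.succ) -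
      MetricCoord.ricAt Gt x (MetricCoord.sharpAt Gt x n) (E4.basisVector k.succ) with hrow
    have hsum : ∑ j, row j = MetricCoord.ricAt H x (MetricCoord.sharpAt Gt x n) (E4.basisVector k.succ) -
        MetricCoord.ricAt Gt x (MetricCoord.sharpAt Gt x n) (E4.basisVector k.succ) := by
      simp only [hrow]
      rw [hinvis k, hsplit k]
    have hown_eq : row i = ∑ j, row j - ∑ j ∈ Finset.univ.erase i, row j := by
      rw [← firstOrder_sum_sub_own' row i]; ring
    have hfarsum : |∑ j ∈ Finset.univ.erase i, row j| ≤ max C 0 * (1 + (B + N)) * δv * R := by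
      calc |∑ j ∈ Finset.univ.erase i, row j| ≤ ∑ j ∈ Finset.univ.erase i, |row j| := Finset.abs_sum_le_sum_abs _ _
        _ ≤ ∑ j ∈ Finset.univ.erase i, max C 0 * (1 + (B + N)) * (δv * red j) :=
            Finset.sum_le_sum fun j hj ↦ hfar j (Finset.ne_of_mem_erase hj) k
        _ ≤ ∑ j, max C 0 * (1 + (B + N)) * (δv * red j) :=
            Finset.sum_le_sum_of_subset_of_nonneg (Finset.erase_subset _ _) fun j _ _ ↦ by
              have := hred0 j; positivity
        _ = max C 0 * (1 + (B + N)) * δv * R := by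
            rw [hR, Finset.mul_sum]
            exact Finset.sum_congr rfl fun j _ ↦ by ring
    show |row i| ≤ _
    rw [hown_eq, hsum]
    calc _ ≤ |MetricCoord.ricAt H x (MetricCoord.sharpAt Gt x n) (E4.basisVector k.succ) -
          MetricCoord.ricAt Gt x (MetricCoord.sharpAt Gt x n) (E4.basisVector k.succ)| +
          |∑ j ∈ Finset.univ.erase i, row j| := abs_sub _ _
      _ ≤ (|MetricCoord.ricAt H x (MetricCoord.sharpAt Gt x n) (E4.basisVector k.succ)| +
          |MetricCoord.ricAt Gt x (MetricCoord.sharpAt Gt x n) (E4.basisVector k.succ)|) +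
          |∑ j ∈ Finset.univ.erase i, row j| := by gcongr; exact abs_sub _ _
      _ ≤ (ε₁ * l + (12 * (s ^ 3 * (5 * (B + 2 * N) ^ 2 + (B + 2 * N)) + 5 * s ^ 2 * (B + 2 * N) + s) * N) * δf * s) +
          max C 0 * (1 + (B + N)) * δv * R := add_le_add (add_le_add (hrowsH k) (hrowsG k)) hfarsum
      _ = _ := by ring
  -- sum over the three rows
  have hfin3 : ∑ k : Fin 3, |MetricCoord.ricAt (fun z ↦ Gt z + (n z - t) • ∑ j' ∈ ({i} : Finset (Fin N)), Vl j' z) x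
          (MetricCoord.sharpAt Gt x n) (E4.basisVector k.succ) -
        MetricCoord.ricAt Gt x (MetricCoord.sharpAt Gt x n) (E4.basisVector k.succ)| ≤
      3 * (ε₁ * l + (12 * (s ^ 3 * (5 * (B + 2 * N) ^ 2 + (B + 2 * N)) + 5 * s ^ 2 * (B + 2 * N) + s) * N) * δf * s +
        max C 0 * (1 + (B + N)) * δv * R) := by
    calc _ ≤ ∑ _k : Fin 3, (ε₁ * l + (12 * (s ^ 3 * (5 * (B + 2 * N) ^ 2 + (B + 2 * N)) + 5 * s ^ 2 * (B + 2 * N) + s) * N) * δf * s +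
        max C 0 * (1 + (B + N)) * δv * R) := Finset.sum_le_sum fun k _ ↦ hown k
      _ = _ := by
          simp only [Finset.sum_const, Finset.card_univ, Fintype.card_fin, nsmul_eq_mul, Nat.cast_ofNat]
  -- the own field with the singleton sum is the own field
  have hsing : (fun z ↦ Gt z + (n z - t) • ∑ j' ∈ ({i} : Finset (Fin N)), Vl j' z) =
      fun z ↦ Gt z + (n z - t) • Vl i z := by
    funext z; rw [Finset.sum_singleton]
  rw [hsing] at hfin3
  rw [hl] at hfin3
  exact hfin3

end CoreB

/-- **Registered one-line carrier form** (`firstOrder_norm_dx_D11`, stub (D) of the crux item) of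
`firstOrder_norm_dx_basis`. [folklore] -/
theorem firstOrder_norm_dx_D11 : open Literature.Geometry.Lorentzian in ∀ k : Fin 3, ‖(E4.dx 0 : E4 →L[ℝ] ℝ)‖ ≤ 1 ∧ ‖(E4.basisVector k.succ : E4)‖ = 1 :=
  firstOrder_norm_dx_basis

end Summit.FinalStateConjecture.FinalStateConjecture.Theorems.SublinearIsFree.Slaving

end
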